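import Mathlib
import HarnessLib
import HarnessLib.Audit
import Summits.ValiantsHypothesis.ValiantsHypothesis.Theorems.LacunarySymmetroidMatrixDescartesZeroChangeRows

/-!
# ValiantsHypothesis / LacunarySymmetroid — crux `MatrixDescartes` (stmt-ValiantsHypothesis-18050, V1), LINE (A) «product_plus_one»:
# the PICK COUNT for binomial companies (pen val-idea-25 g9 NOTE §56.7 corollary (a); card `arrangement-concavity-dip-count`)

NOTE §56.7 (pen val-idea-25 g9), corollary (a): for a BINOMIAL company — rows `g_j = a₀ + a₂X^c` with vanishing middle letter
(the `η → 0` / `M ≡ 0` corner of LINE (A)) — the floor count `posCrit (∏ g_j)` (number of distinct positive critical points of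
`Φ = ∏ g_j`; `row`, `posCrit` of module `…ZeroChangeRows`) is at most `r − 1` («Pick count»; `= r − 1` when every row changes sign).
Proof: `Φ = P(X^c)` with `P = ∏_j (a₀ⱼ + a₂ⱼX)` of degree `≤ r`, `Φ′ = cX^{c−1}·P′(X^c)`, and `t ↦ t^c` is injective on `(0,∞)`,
so the distinct positive critical points of `Φ` inject into the roots of `P′`, which number `≤ deg P − 1 ≤ r − 1`.

HONEST FRAMING: an exact free-standing count in the binomial corner (the TRUE count, not a Descartes bound); NOT P6 / the floor law /
`OneRowZeroChange k`; no stub of LINE (A) is touched (A40 unchanged, sorries 4 → 4); `MatrixDescartes` OPEN; `VP ≠ VNP` is NOT proved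
and nothing here bears on it.
-/

set_option linter.dupNamespace false

namespace Summit.ValiantsHypothesis.ValiantsHypothesis.Theorems.LacunarySymmetroidMatrixDescartes

namespace ZeroChange

open Polynomial Finset

/-- A binomial row is the linear row composed with `X^c`: `a₀ + a₂X^c = (a₀ + a₂X) ∘ X^c`. -/
theorem row_binomial_eq_comp (a c : ℕ) (a₀ a₂ : ℝ) : row a c a₀ 0 a₂ = (C a₀ + C a₂ * X).comp (X ^ c) := by
  simp [row, add_comp, mul_comp, C_comp, X_comp]

/-- **PICK COUNT (NOTE §56.7 corollary (a))**: a company of `m` binomial rows `a₀ⱼ + a₂ⱼX^c` has at most `m − 1` distinct positive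
critical points. -/
theorem pickCount_binomial : ∀ (m a c : ℕ), 0 < a → a < c → ∀ (a₀ a₂ : Fin m → ℝ),
    posCrit (∏ j, row a c (a₀ j) 0 (a₂ j)) ≤ m - 1 := by
  intro m a c ha hac a₀ a₂
  classical
  have hc : 0 < c := ha.trans hac
  set P : ℝ[X] := ∏ j, (C (a₀ j) + C (a₂ j) * X) with hP
  have hΦ : ∏ j, row a c (a₀ j) 0 (a₂ j) = P.comp (X ^ c) := by
    rw [hP, Polynomial.prod_comp]
    exact prod_congr rfl fun j _ => row_binomial_eq_comp a c (a₀ j) (a₂ j)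
  -- degree of P and of P′
  have hPdeg : P.natDegree ≤ m := by
    rw [hP]
    refine (natDegree_prod_le _ _).trans ?_
    have h1 : ∀ j ∈ (univ : Finset (Fin m)), (C (a₀ j) + C (a₂ j) * X).natDegree ≤ 1 := fun j _ =>
      (natDegree_add_le _ _).trans (max_le (by simp) ((natDegree_C_mul_le _ _).trans (by simp)))
    exact (sum_le_sum h1).trans (by simp)
  have hP'deg : (derivative P).natDegree ≤ m - 1 := (natDegree_derivative_le P).trans (Nat.sub_le_sub_right hPdeg 1)
  rw [posCrit, hΦ, derivative_comp]
  by_cases hP' : derivative P = 0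
  · simp [hP']
  -- the distinct positive roots of Φ′ inject into the roots of P′ via t ↦ t^c
  set F := ((derivative (X ^ c : ℝ[X]) * (derivative P).comp (X ^ c)).roots.toFinset.filter (fun t => 0 < t)) with hF
  have hmem : ∀ t ∈ F, 0 < t ∧ (derivative P).eval (t ^ c) = 0 := by
    intro t ht
    rw [hF, mem_filter, Multiset.mem_toFinset] at ht
    obtain ⟨hroot, htpos⟩ := ht
    refine ⟨htpos, ?_⟩
    have hne : derivative (X ^ c : ℝ[X]) * (derivative P).comp (X ^ c) ≠ 0 := (mem_roots'.1 hroot).1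
    have heval := (mem_roots hne).1 hroot
    rw [IsRoot.def, eval_mul, derivative_X_pow, eval_mul, eval_C, eval_pow, eval_X, eval_comp, eval_pow, eval_X,
      mul_eq_zero] at heval
    rcases heval with h | h
    · exfalso
      have : (0 : ℝ) < (c : ℝ) * t ^ (c - 1) := by positivity
      exact this.ne' h
    · exact h
  have hinj : Set.InjOn (fun t : ℝ => t ^ c) (F : Set ℝ) := by
    intro x hx y hy hxy
    exact (pow_left_inj₀ (hmem x hx).1.le (hmem y hy).1.le hc.ne').1 hxy
  have hmaps : ∀ t ∈ F, (fun t : ℝ => t ^ c) t ∈ (derivative P).roots.toFinset := by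
    intro t ht
    rw [Multiset.mem_toFinset, mem_roots hP', IsRoot.def]
    exact (hmem t ht).2
  calc F.card ≤ (derivative P).roots.toFinset.card := Finset.card_le_card_of_injOn _ hmaps hinj
    _ ≤ Multiset.card (derivative P).roots := Multiset.toFinset_card_le _
    _ ≤ (derivative P).natDegree := card_roots' _
    _ ≤ m - 1 := hP'deg

end ZeroChange

end Summit.ValiantsHypothesis.ValiantsHypothesis.Theorems.LacunarySymmetroidMatrixDescartes
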